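import Literature.AnabelianGeometry.EtaleTheta.LogDivisorModelConstantFieldGalois
import Literature.AnabelianGeometry.EtaleTheta.Discharge.Sec3Prop34CnstTorsionOfGaloisCovering

/-!
# [EtTh] Thm. 3.7 (iii), `Λ = ℚ` clause: the torsion Galois-correspondence law from a constant field, MODULO the
# two arithmetic inputs it needs (bounded roots of unity; powers of units generate)

S. Mochizuki, *The étale theta function …*, Publ. RIMS **45** (2009) [MochizukiEtTh2009], §3, Thm. 3.7 (iii), PRIMS
PDF p.79 l.−6 – p.80 l.2 ("… If, moreover, `Λ ∈ {ℤ, ℚ}`, then this factorization determines a faithful action of the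
image of `Aut_C(A)` in `Aut_{D^cnst}(A^cnst)` on `O^▷(A)`, `O^×(A)`"), Prop. 3.4 (ii) p.74
[cite: MochizukiEtTh2009, Thm 3.7 (iii) p.79].

PROOF-ONLY (abc-iut cell, W6 seat d058 lineage, gen 3; 0 defs).  abc-iut-L2-t3's binder
`GaloisAction.ConstGaloisLawTorsion A` (p447930; the `Λ = ℚ` reading: fixing `H`-invariant unit integral constants UP
TO TORSION forces membership in `N·H`) is strictly stronger than `ConstGaloisLaw` and is NOT implied by a constant-field
structure `GaloisAction.ConstField` alone (`ConstGaloisLawTorsionNegative.lean`: it fails at the finite constant field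
`𝔽_4/𝔽_2`).  This file isolates EXACTLY the extra arithmetic of the constant field `(L, v)` that the `Λ = ℚ` clause
uses, as two named hypotheses on a `ConstField`, and proves the torsion law from them by the same two steps as the
`Λ = ℤ` law (units generate ⇒ `res a` fixes `L^{res(H)}`; Galois correspondence):
* (hμ) the roots of unity of `L` have bounded order: some `m ≥ 1` kills every torsion element of `L^×`
  (print: `μ(L)` is finite for `L/ℚ_p` finite);
* (hgen) for every intermediate field `F` of `L/K`, the `m`-th powers of the units of the valuation ring of `F`
  generate `F` as a field (print: for `L/ℚ_p` finite, `(O_F^×)^m` contains an open subgroup `1 + 𝔪_F^k`, whose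
  differences exhaust `𝔪_F^k`, which generates `F`) — FALSE for a finite constant field, where it is the obstruction.
Results: `ConstField.pow_eq_pow_of_actFn_pow_eq` (the torsion hypothesis read in `L`), `ConstField.res_apply_pow_eq`
(`res a` fixes `y^m` for every `H`-invariant unit `y`), `ConstField.res_mem_fixingSubgroup_of_torsion`,
**`ConstField.constGaloisLawTorsion_of_pow_units_generate`**.  Discharging (hμ)/(hgen) for `p`-adic `L` is the
local-field lane's input (Hensel), not attempted here.  HONEST FRAMING: classical algebra over typed interfaces;
nothing here bears on [IUTchIII] Cor. 3.12; no side taken; typed ≠ proved.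
-/

namespace Literature.AnabelianGeometry.EtaleTheta

namespace LogDivisorModel.GaloisAction.ConstField

universe u v w

variable {Z : LogDivisorModel.{u}} {G : Type u} [Group G] {A : Z.GaloisAction G}
  {K L : Type v} [Field K] [Field L] [Algebra K L] {Γ₀ : Type w} [LinearOrderedCommGroupWithZero Γ₀]
  (C : A.ConstField K L Γ₀)

/-- The torsion hypothesis read in the constant field: `(a · emb x)^N = (emb x)^N` iff `(res a x)^N = x^N` in `L`.
[cite: MochizukiEtTh2009, Thm 3.7 (iii) p.79] -/
theorem pow_eq_pow_of_actFn_pow_eq (a : G) (x : Lˣ) (N : ℕ)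
    (h : (A.actFn a (C.emb x)) ^ N = (C.emb x) ^ N) : (C.res a (x : L)) ^ N = (x : L) ^ N := by
  have h' : C.emb ((Units.map (C.res a : L →* L) x) ^ N) = C.emb (x ^ N) := by
    rw [map_pow, map_pow, ← C.actFn_emb]; exact h
  have h'' := C.emb_injective h'
  rw [Units.ext_iff, Units.val_pow_eq_pow_val, Units.val_pow_eq_pow_val, Units.coe_map, MonoidHom.coe_coe] at h''
  exact h''

/-- If `(σ y)^N = y^N` with `N ≥ 1` and every torsion element of `L^×` is killed by `m`, then `σ (y^m) = y^m`.
[cite: MochizukiEtTh2009, Thm 3.7 (iii) p.79] -/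
theorem apply_pow_eq_of_pow_eq_pow (m : ℕ+) (hμ : ∀ (ζ : L) (n : ℕ+), ζ ^ (n : ℕ) = 1 → ζ ^ (m : ℕ) = 1)
    (σ : L ≃ₐ[K] L) {y : L} (hy : y ≠ 0) (N : ℕ+) (h : (σ y) ^ (N : ℕ) = y ^ (N : ℕ)) :
    σ (y ^ (m : ℕ)) = y ^ (m : ℕ) := by
  have hyN : y ^ (N : ℕ) ≠ 0 := pow_ne_zero _ hy
  have hζ : (σ y / y) ^ (N : ℕ) = 1 := by rw [div_pow, h, div_self hyN]
  have hζm := hμ (σ y / y) N hζ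
  rw [div_pow, div_eq_one_iff_eq (pow_ne_zero _ hy)] at hζm
  rw [map_pow, hζm]

/-- Under the torsion hypothesis of the binder and (hμ), `res a` fixes `y^m` for every element `y` of valuation `1`
of the fixed field of `res(H)`. [cite: MochizukiEtTh2009, Thm 3.7 (iii) p.79] -/
theorem res_apply_pow_eq (m : ℕ+) (hμ : ∀ (ζ : L) (n : ℕ+), ζ ^ (n : ℕ) = 1 → ζ ^ (m : ℕ) = 1)
    (H : Subgroup G) (a : G)
    (ha : ∀ u : Z.Fn, u ∈ Z.intConst → u⁻¹ ∈ Z.intConst → (∀ h ∈ H, A.actFn h u = u) →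
      ∃ N : ℕ+, (A.actFn a u) ^ (N : ℕ) = u ^ (N : ℕ))
    (y : L) (hyF : y ∈ IntermediateField.fixedField (H.map C.res)) (hy : C.v y = 1) :
    C.res a (y ^ (m : ℕ)) = y ^ (m : ℕ) := by
  have hy0 : y ≠ 0 := fun h => by rw [h, map_zero] at hy; exact zero_ne_one hy
  obtain ⟨hint, hint'⟩ := C.emb_mem_intConst_and_inv_mem (Units.mk0 y hy0) hy
  have hH : ∀ h ∈ H, A.actFn h (C.emb (Units.mk0 y hy0)) = C.emb (Units.mk0 y hy0) := fun h hh =>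
    (C.actFn_emb_eq_iff h _).2 ((IntermediateField.mem_fixedField_iff (H.map C.res) y).1 hyF (C.res h)
      (Subgroup.mem_map_of_mem C.res hh))
  obtain ⟨N, hN⟩ := ha _ hint hint' hH
  exact apply_pow_eq_of_pow_eq_pow m hμ (C.res a) hy0 N (C.pow_eq_pow_of_actFn_pow_eq a (Units.mk0 y hy0) N hN)

/-- Step 1 of the torsion law: under the binder's torsion hypothesis, (hμ) and (hgen), `res a` fixes the WHOLE fixed
field `F = L^{res(H)}` — the `m`-th powers of the units of `O_F` generate `F`.
[cite: MochizukiEtTh2009, Thm 3.7 (iii) p.79] -/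
theorem res_mem_fixingSubgroup_of_torsion (m : ℕ+) (hμ : ∀ (ζ : L) (n : ℕ+), ζ ^ (n : ℕ) = 1 → ζ ^ (m : ℕ) = 1)
    (hgen : ∀ F : IntermediateField K L,
      Subfield.closure {x : F | ∃ y : F, C.v (y : L) = 1 ∧ y ^ (m : ℕ) = x} = ⊤)
    (H : Subgroup G) (a : G)
    (ha : ∀ u : Z.Fn, u ∈ Z.intConst → u⁻¹ ∈ Z.intConst → (∀ h ∈ H, A.actFn h u = u) →
      ∃ N : ℕ+, (A.actFn a u) ^ (N : ℕ) = u ^ (N : ℕ)) :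
    C.res a ∈ IntermediateField.fixingSubgroup (IntermediateField.fixedField (H.map C.res)) := by
  rw [IntermediateField.mem_fixingSubgroup_iff]
  intro y hyF
  let F : IntermediateField K L := IntermediateField.fixedField (H.map C.res)
  have key := RingHom.eq_of_eqOn_of_field_closure_eq_top (hgen F)
    (f := ((C.res a : L ≃ₐ[K] L) : L →+* L).comp (algebraMap F L)) (g := algebraMap F L) ?_
  · exact RingHom.congr_fun key ⟨y, hyF⟩
  · rintro x ⟨z, hz, rfl⟩
    change C.res a (((z ^ (m : ℕ) : F) : L)) = ((z ^ (m : ℕ) : F) : L)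
    rw [SubmonoidClass.coe_pow]
    exact C.res_apply_pow_eq m hμ H a ha (z : L) z.2 hz

/-- **The `Λ = ℚ` (torsion) Galois-correspondence law from a constant field, modulo its two arithmetic inputs**:
given (hμ) bounded roots of unity and (hgen) "`m`-th powers of units generate every intermediate field",
abc-iut-L2-t3's binder `ConstGaloisLawTorsion` HOLDS.  (Both inputs hold for `L/ℚ_p` finite; (hgen) fails for a finite
constant field, where the law fails — `ConstGaloisLawTorsionNegative.lean`.) [cite: MochizukiEtTh2009, Thm 3.7 (iii) p.79] -/
theorem constGaloisLawTorsion_of_pow_units_generate (m : ℕ+)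
    (hμ : ∀ (ζ : L) (n : ℕ+), ζ ^ (n : ℕ) = 1 → ζ ^ (m : ℕ) = 1)
    (hgen : ∀ F : IntermediateField K L,
      Subfield.closure {x : F | ∃ y : F, C.v (y : L) = 1 ∧ y ^ (m : ℕ) = x} = ⊤) :
    A.ConstGaloisLawTorsion := by
  haveI := C.finiteDimensional
  refine ⟨fun H a ha => ?_⟩
  have hmem : C.res a ∈ H.map C.res := by
    rw [← IntermediateField.fixingSubgroup_fixedField (H.map C.res)]
    exact C.res_mem_fixingSubgroup_of_torsion m hμ hgen H a ha
  obtain ⟨h, hh, hha⟩ := Subgroup.mem_map.1 hmem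
  refine ⟨a * h⁻¹, ?_, ?_⟩
  · rw [C.mem_constInertia_iff, map_mul, map_inv, hha, mul_inv_cancel]
  · rw [mul_inv_rev, inv_inv, inv_mul_cancel_right]
    exact hh

end LogDivisorModel.GaloisAction.ConstField

end Literature.AnabelianGeometry.EtaleTheta
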